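import Mathlib
import HarnessLib
import Summits.KontsevichZagierPeriods.Statement
import Literature.NumberTheory.Transcendental.KZProductIdeal
import Literature.NumberTheory.Transcendental.KZKernelConjectureForms
import Literature.NumberTheory.Transcendental.KZCubeRationalMoves
import Literature.NumberTheory.Transcendental.KZLogCalculusProofs
import Literature.NumberTheory.Transcendental.KZFibreMapMove

/-!
# Census pairs #1 #2 (ℚ(√−7) surd), #24 #28 (dilog), #36 #37 (weight one) DECIDED in `KZ.relations` (route `RootDecompQuadraticDescent`, instances of crux stmt-KontsevichZagierPeriods-28994 `DescentTwoQ` / stmt-4280 `KZDimTwo`) · part 1/6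

Cell `decomp-kz`, lens 6 (decomp-kz-lens-6 g8): the LINEAR-FIBRE STRATUM of the weight-2 box census decided by rules 1+2 in dimension 2 — general lemma `linFibre` (unfolding `s = (α(x)y+β(x))/β(x)` into a log band) + ONE base substitution by the Möbius involution `κ(t) = (1−t)/(1+t)` (`rel_subst`) + `rel_trans`; `pair1`, `pair2` (the ℚ(√−7) live benchmarks of 28994 rev 7), `pair24`, `pair28`, `pair36`, `pair37` (the latter with four `RFun.stokes` steps, rational primitives); packaged `surdPairs_decided`, `surdPairs_descentTwoQ_instances` (∀ R ⊇ relations) and `surdPairs_of_kzDimTwo` BY NAME.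

Source: `HOME/decomp-kz-lens-6/g8/SurdPairs.lean` sha256 a3f0c2d08098ea3e (1516 l; critic decomp-kz-crit-1 g2 CLEARED 2026-08-30T08:39:24Z, std axioms), split into 6 modules by the landing seat decomp-kz-census-1 g7 (contexts re-opened per part; generic docstrings added where the source had none; the route file is imported only by the last part, which proves the `KZDimTwo` corollaries BY NAME).  No `sorry`; standard axioms.  References: [cite: KontsevichZagier2001, §1.2].
-/

noncomputable section

open MeasureTheory Set MvPolynomial

namespace Summit.KontsevichZagierPeriods.RootDecompQuadraticDescent.SurdPairs

open Literature.NumberTheory.Transcendental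
open Literature.NumberTheory.Transcendental.KZ
open Literature.ModelTheory.ExponentialFields (IsSemialgebraic)

/-! ## §1a Small `Fin` bookkeeping and intervals (verbatim from generation 7) -/

/-- `snoc2_zero`: auxiliary theorem of the lens-6 development «surd» (instances of 28994/4280) — see the module docstring; verbatim from the lens file. -/
@[simp] private theorem snoc2_zero (x : Fin 1 → ℝ) (t : ℝ) : (Fin.snoc x t : Fin 2 → ℝ) 0 = x 0 := rfl
/-- `snoc2_one`: auxiliary theorem of the lens-6 development «surd» (instances of 28994/4280) — see the module docstring; verbatim from the lens file. -/
@[simp] private theorem snoc2_one (x : Fin 1 → ℝ) (t : ℝ) : (Fin.snoc x t : Fin 2 → ℝ) 1 = t := rfl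
/-- `init2_zero`: auxiliary theorem of the lens-6 development «surd» (instances of 28994/4280) — see the module docstring; verbatim from the lens file. -/
@[simp] private theorem init2_zero (z : Fin 2 → ℝ) : Fin.init z 0 = z 0 := rfl
/-- `last_one_eq`: auxiliary theorem of the lens-6 development «surd» (instances of 28994/4280) — see the module docstring; verbatim from the lens file. -/
private theorem last_one_eq : (Fin.last 1 : Fin 2) = 1 := rfl
/-- `fin1_eq`: auxiliary theorem of the lens-6 development «surd» (instances of 28994/4280) — see the module docstring; verbatim from the lens file. -/
private theorem fin1_eq (y : Fin 1 → ℝ) : y = fun _ => y 0 := funext fun i => by rw [Fin.fin_one_eq_zero i]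

/-- A regular rational function gives a KZ-rational representation. [folklore] -/
private theorem isRational_rep {M : ℕ} (T : RFun M) : T.rep.IsRational :=
  ⟨T.num, T.den, T.den_ne, fun _ _ => rfl⟩

/-- The interval `[a, b]` as a subset of `ℝ¹`. -/
def ivl (a b : ℚ) : Set (Fin 1 → ℝ) := {y | (a : ℝ) ≤ y 0 ∧ y 0 ≤ b}

/-- `mem_ivl`: auxiliary theorem of the lens-6 development «surd» (instances of 28994/4280) — see the module docstring; verbatim from the lens file. -/
theorem mem_ivl {a b : ℚ} {y : Fin 1 → ℝ} : y ∈ ivl a b ↔ (a : ℝ) ≤ y 0 ∧ y 0 ≤ b := Iff.rfl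

/-- `isSemialgebraic_ivl`: auxiliary theorem of the lens-6 development «surd» (instances of 28994/4280) — see the module docstring; verbatim from the lens file. -/
theorem isSemialgebraic_ivl (a b : ℚ) : IsSemialgebraic ℚ (ivl a b) := by
  have h1 := Literature.ModelTheory.ExponentialFields.isSemialgebraic_setOf_eval_le (k := ℚ) (R := ℝ)
    (C a : MvPolynomial (Fin 1) ℚ) (X 0)
  have h2 := Literature.ModelTheory.ExponentialFields.isSemialgebraic_setOf_eval_le (k := ℚ) (R := ℝ)
    (X 0 : MvPolynomial (Fin 1) ℚ) (C b)
  have h := h1.inter h2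
  simp only [MvPolynomial.aeval_C, MvPolynomial.aeval_X, eq_ratCast] at h
  have hset : ivl a b = {y : Fin 1 → ℝ | (a : ℝ) ≤ y 0} ∩ {y | y 0 ≤ (b : ℝ)} := by
    ext y; simp [ivl]
  rw [hset]
  exact h

/-- `ivl_eq_Icc`: auxiliary theorem of the lens-6 development «surd» (instances of 28994/4280) — see the module docstring; verbatim from the lens file. -/
theorem ivl_eq_Icc (a b : ℚ) : ivl a b = Icc (fun _ => (a : ℝ)) (fun _ => (b : ℝ)) := by
  ext y
  simp only [ivl, mem_setOf_eq, mem_Icc, Pi.le_def, Fin.forall_fin_one]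

/-- `cube_eq_band`: auxiliary theorem of the lens-6 development «surd» (instances of 28994/4280) — see the module docstring; verbatim from the lens file. -/
theorem cube_eq_band : cube 2 = KZlog.band (ivl 0 1) (fun _ => 0) fun _ => 1 := by
  ext z
  rw [KZlog.mem_band, last_one_eq, mem_ivl, mem_cube, Fin.forall_fin_two]
  simp only [init2_zero, Rat.cast_zero, Rat.cast_one]

/-! ## §1b Logarithmic arguments, base weights and the band representations `LB` -/

/-- The data of a logarithmic argument `v ≥ 1` over `[a, b]`. -/
structure LogArg (a b : ℚ) where
  v : ℝ → ℝ
  sa : IsSemialgebraicFunOn ℚ (ivl a b) (fun y => v (y 0))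
  one_le : ∀ t ∈ Icc (a : ℝ) b, 1 ≤ v t
  cont : ContinuousOn v (Icc (a : ℝ) b)

namespace LogArg

variable {a b : ℚ}

/-- `pos`: auxiliary theorem of the lens-6 development «surd» (instances of 28994/4280) — see the module docstring; verbatim from the lens file. -/
theorem pos (V : LogArg a b) {t : ℝ} (ht : t ∈ Icc (a : ℝ) b) : 0 < V.v t :=
  lt_of_lt_of_le one_pos (V.one_le t ht)

/-- `exists_bound`: auxiliary theorem of the lens-6 development «surd» (instances of 28994/4280) — see the module docstring; verbatim from the lens file. -/
theorem exists_bound (V : LogArg a b) : ∃ M, ∀ t ∈ Icc (a : ℝ) b, V.v t ≤ M := by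
  obtain ⟨C, hC⟩ := isCompact_Icc.exists_bound_of_continuousOn V.cont
  exact ⟨C, fun t ht => (le_abs_self _).trans (by simpa using hC t ht)⟩

/-- Restriction of a logarithmic argument to a subinterval. -/
def restr (V : LogArg a b) (a' b' : ℚ) (h : (a : ℝ) ≤ a' ∧ (b' : ℝ) ≤ b) : LogArg a' b' where
  v := V.v
  sa := V.sa.mono (fun _ hy => ⟨h.1.trans hy.1, hy.2.trans h.2⟩) (isSemialgebraic_ivl a' b')
  one_le t ht := V.one_le t ⟨h.1.trans ht.1, ht.2.trans h.2⟩
  cont := V.cont.mono (Icc_subset_Icc h.1 h.2)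

/-- `restr_v`: auxiliary theorem of the lens-6 development «surd» (instances of 28994/4280) — see the module docstring; verbatim from the lens file. -/
@[simp] theorem restr_v (V : LogArg a b) (a' b' : ℚ) (h) : (V.restr a' b' h).v = V.v := rfl

end LogArg

/-- A logarithmic argument given on `[a,b]` by a quotient of polynomials. -/
def mkArg (a b : ℚ) (v : ℝ → ℝ) (P Q : MvPolynomial (Fin 1) ℚ) (hQ : ∀ y ∈ ivl a b, aeval y Q ≠ 0)
    (hPQ : ∀ y ∈ ivl a b, aeval y P / aeval y Q = v (y 0)) (h1 : ∀ t ∈ Icc (a : ℝ) b, 1 ≤ v t)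
    (hc : ContinuousOn v (Icc (a : ℝ) b)) : LogArg a b :=
  ⟨v, (isSemialgebraicFunOn_aeval_div_aeval (isSemialgebraic_ivl a b) P Q hQ).congr hPQ, h1, hc⟩

/-- `mkArg_v`: auxiliary theorem of the lens-6 development «surd» (instances of 28994/4280) — see the module docstring; verbatim from the lens file. -/
@[simp] theorem mkArg_v (a b : ℚ) (v : ℝ → ℝ) (P Q hQ hPQ h1 hc) : (mkArg a b v P Q hQ hPQ h1 hc).v = v := rfl

/-- The data of a `ℚ`-semialgebraic continuous base weight `w(t)` over `[a, b]` (NEW in generation 8: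
generation 7 hard-wired `w = c/(1−t+t²)`). -/
structure BaseWt (a b : ℚ) where
  w : ℝ → ℝ
  sa : IsSemialgebraicFunOn ℚ (ivl a b) (fun y => w (y 0))
  cont : ContinuousOn w (Icc (a : ℝ) b)

namespace BaseWt

variable {a b : ℚ}

/-- `exists_bound`: auxiliary theorem of the lens-6 development «surd» (instances of 28994/4280) — see the module docstring; verbatim from the lens file. -/
theorem exists_bound (W : BaseWt a b) : ∃ M, ∀ t ∈ Icc (a : ℝ) b, |W.w t| ≤ M := by
  obtain ⟨C, hC⟩ := isCompact_Icc.exists_bound_of_continuousOn W.cont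
  exact ⟨C, fun t ht => by simpa [Real.norm_eq_abs] using hC t ht⟩

/-- Restriction of a base weight to a subinterval. -/
def restr (W : BaseWt a b) (a' b' : ℚ) (h : (a : ℝ) ≤ a' ∧ (b' : ℝ) ≤ b) : BaseWt a' b' where
  w := W.w
  sa := W.sa.mono (fun _ hy => ⟨h.1.trans hy.1, hy.2.trans h.2⟩) (isSemialgebraic_ivl a' b')
  cont := W.cont.mono (Icc_subset_Icc h.1 h.2)

/-- `restr_w`: auxiliary theorem of the lens-6 development «surd» (instances of 28994/4280) — see the module docstring; verbatim from the lens file. -/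
@[simp] theorem restr_w (W : BaseWt a b) (a' b' : ℚ) (h) : (W.restr a' b' h).w = W.w := rfl

end BaseWt

/-- A base weight given on `[a,b]` by a quotient of polynomials. -/
def mkWt (a b : ℚ) (w : ℝ → ℝ) (P Q : MvPolynomial (Fin 1) ℚ) (hQ : ∀ y ∈ ivl a b, aeval y Q ≠ 0)
    (hPQ : ∀ y ∈ ivl a b, aeval y P / aeval y Q = w (y 0)) (hc : ContinuousOn w (Icc (a : ℝ) b)) :
    BaseWt a b :=
  ⟨w, (isSemialgebraicFunOn_aeval_div_aeval (isSemialgebraic_ivl a b) P Q hQ).congr hPQ, hc⟩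

/-- `mkWt_w`: auxiliary theorem of the lens-6 development «surd» (instances of 28994/4280) — see the module docstring; verbatim from the lens file. -/
@[simp] theorem mkWt_w (a b : ℚ) (w : ℝ → ℝ) (P Q hQ hPQ hc) : (mkWt a b w P Q hQ hPQ hc).w = w := rfl

/-- The band `{(t, s) : a ≤ t ≤ b, 1 ≤ s ≤ v(t)}` over the interval. -/
def bandOf (a b : ℚ) (V : LogArg a b) : Set (Fin 2 → ℝ) :=
  KZlog.band (ivl a b) (fun _ => 1) (fun y => V.v (y 0))

/-- `mem_bandOf`: auxiliary theorem of the lens-6 development «surd» (instances of 28994/4280) — see the module docstring; verbatim from the lens file. -/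
theorem mem_bandOf {a b : ℚ} {V : LogArg a b} {z : Fin 2 → ℝ} :
    z ∈ bandOf a b V ↔ ((a : ℝ) ≤ z 0 ∧ z 0 ≤ b) ∧ 1 ≤ z 1 ∧ z 1 ≤ V.v (z 0) := Iff.rfl

/-- `isSemialgebraic_bandOf`: auxiliary theorem of the lens-6 development «surd» (instances of 28994/4280) — see the module docstring; verbatim from the lens file. -/
theorem isSemialgebraic_bandOf (a b : ℚ) (V : LogArg a b) : IsSemialgebraic ℚ (bandOf a b V) :=
  KZlog.isSemialgebraic_band (by simpa using isSemialgebraicFunOn_ratCast (isSemialgebraic_ivl a b) 1)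
    V.sa

/-- `bandOf_subset_Icc`: auxiliary theorem of the lens-6 development «surd» (instances of 28994/4280) — see the module docstring; verbatim from the lens file. -/
theorem bandOf_subset_Icc {a b : ℚ} (V : LogArg a b) {M : ℝ} (hM : ∀ t ∈ Icc (a : ℝ) b, V.v t ≤ M) :
    bandOf a b V ⊆ Icc ![(a : ℝ), 1] ![(b : ℝ), M] := by
  intro z hz
  rcases mem_bandOf.1 hz with ⟨⟨h1, h2⟩, h3, h4⟩
  refine ⟨fun i => ?_, fun i => ?_⟩ <;> fin_cases i
  · simpa using h1
  · simpa using h3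
  · simpa using h2
  · simpa using h4.trans (hM _ ⟨h1, h2⟩)

/-- `volume_bandOf_lt_top`: auxiliary theorem of the lens-6 development «surd» (instances of 28994/4280) — see the module docstring; verbatim from the lens file. -/
theorem volume_bandOf_lt_top (a b : ℚ) (V : LogArg a b) : volume (bandOf a b V) < ⊤ := by
  obtain ⟨M, hM⟩ := V.exists_bound
  exact (measure_mono (bandOf_subset_Icc V hM)).trans_lt measure_Icc_lt_top

/-- `isSemialgebraicFunOn_wt`: auxiliary theorem of the lens-6 development «surd» (instances of 28994/4280) — see the module docstring; verbatim from the lens file. -/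
theorem isSemialgebraicFunOn_wt (a b : ℚ) (W : BaseWt a b) (V : LogArg a b) :
    IsSemialgebraicFunOn ℚ (bandOf a b V) (fun z => W.w (z 0) / z 1) := by
  have hB := isSemialgebraic_bandOf a b V
  have h1 : IsSemialgebraicFunOn ℚ (bandOf a b V) (fun z : Fin 2 → ℝ => W.w (Fin.init z 0)) :=
    W.sa.comp_init_mono hB fun z hz => hz.1
  have h2 : IsSemialgebraicFunOn ℚ (bandOf a b V) (fun z : Fin 2 → ℝ => (1 : ℝ) / z 1) := by
    refine (isSemialgebraicFunOn_aeval_div_aeval hB (1 : MvPolynomial (Fin 2) ℚ) (X 1)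
      fun z hz => ?_).congr fun z _ => ?_
    · have h : (1 : ℝ) ≤ z 1 := (mem_bandOf.1 hz).2.1
      simp only [aeval_X]
      exact (lt_of_lt_of_le one_pos h).ne'
    · simp
  exact (IsSemialgebraicFunOn.mul_holds h1 h2).congr fun z _ => by
    simp only [Pi.mul_apply, init2_zero]; ring

/-- `continuousOn_wt`: auxiliary theorem of the lens-6 development «surd» (instances of 28994/4280) — see the module docstring; verbatim from the lens file. -/
theorem continuousOn_wt (a b : ℚ) (W : BaseWt a b) (V : LogArg a b) :
    ContinuousOn (fun z : Fin 2 → ℝ => W.w (z 0) / z 1) (bandOf a b V) := by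
  refine ContinuousOn.div ?_ (continuous_apply 1).continuousOn fun z hz => ?_
  · exact W.cont.comp (continuous_apply 0).continuousOn fun z hz => (mem_bandOf.1 hz).1
  · have h : (1 : ℝ) ≤ z 1 := (mem_bandOf.1 hz).2.1
    exact (lt_of_lt_of_le one_pos h).ne'

/-- **`LB(a,b,W,V) = [ {a ≤ t ≤ b, 1 ≤ s ≤ V(t)}, w(t) · ds dt / s ]`**, the unfolded form of the
one-dimensional logarithmic term `∫_a^b w(t) log V(t) dt`. -/
def LB (a b : ℚ) (W : BaseWt a b) (V : LogArg a b) : KZ.IntegralRep 2 where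
  domain := bandOf a b V
  integrand z := W.w (z 0) / z 1
  isSemialgebraic_domain := isSemialgebraic_bandOf a b V
  isSemialgebraicFunOn_integrand := isSemialgebraicFunOn_wt a b W V
  integrableOn := by
    have hB := isSemialgebraic_bandOf a b V
    obtain ⟨M, hM⟩ := W.exists_bound
    refine IntegrableOn.of_bound (volume_bandOf_lt_top a b V)
      ((continuousOn_wt a b W V).aestronglyMeasurable (IsSemialgebraic.measurableSet_holds hB)) M ?_
    refine (ae_restrict_iff' (IsSemialgebraic.measurableSet_holds hB)).2 (ae_of_all _ fun z hz => ?_)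
    have hz0 : z 0 ∈ Icc (a : ℝ) b := (mem_bandOf.1 hz).1
    have h2 : (1 : ℝ) ≤ z 1 := (mem_bandOf.1 hz).2.1
    rw [Real.norm_eq_abs, abs_div, abs_of_pos (show (0 : ℝ) < z 1 by linarith)]
    exact (div_le_self (abs_nonneg _) h2).trans (hM _ hz0)

/-- `LB_domain`: auxiliary theorem of the lens-6 development «surd» (instances of 28994/4280) — see the module docstring; verbatim from the lens file. -/
@[simp] theorem LB_domain (a b : ℚ) (W : BaseWt a b) (V : LogArg a b) :
    (LB a b W V).domain = bandOf a b V := rfl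
/-- `LB_integrand`: auxiliary theorem of the lens-6 development «surd» (instances of 28994/4280) — see the module docstring; verbatim from the lens file. -/
@[simp] theorem LB_integrand (a b : ℚ) (W : BaseWt a b) (V : LogArg a b) (z : Fin 2 → ℝ) :
    (LB a b W V).integrand z = W.w (z 0) / z 1 := rfl

/-! ## §1c Generic moves on the representations `LB` -/

/-- **Cutting the interval** at an interior rational point (rule 1a; the two bands meet in the null
fibre `{t = m}`). -/
theorem rel_cut (a m b : ℚ) (W : BaseWt a b) (V : LogArg a b) (ham : a ≤ m) (hmb : m ≤ b) :
    KZ.of (LB a b W V) -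
      KZ.of (LB a m (W.restr a m ⟨le_rfl, by exact_mod_cast hmb⟩) (V.restr a m ⟨le_rfl, by exact_mod_cast hmb⟩)) -
      KZ.of (LB m b (W.restr m b ⟨by exact_mod_cast ham, le_rfl⟩) (V.restr m b ⟨by exact_mod_cast ham, le_rfl⟩))
        ∈ KZ.relations := by
  refine KZ.domainAddRel_subset_relations ⟨2, LB a b W V,
    LB a m (W.restr a m ⟨le_rfl, by exact_mod_cast hmb⟩) (V.restr a m ⟨le_rfl, by exact_mod_cast hmb⟩),
    LB m b (W.restr m b ⟨by exact_mod_cast ham, le_rfl⟩) (V.restr m b ⟨by exact_mod_cast ham, le_rfl⟩),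
    ?_, ?_, fun z _ => rfl, fun z _ => rfl, rfl⟩
  · ext z
    simp only [LB_domain, mem_union, mem_bandOf, LogArg.restr_v]
    have hm1 : ((m : ℚ) : ℝ) ≤ b := by exact_mod_cast hmb
    have hm2 : ((a : ℚ) : ℝ) ≤ m := by exact_mod_cast ham
    constructor
    · rintro ⟨⟨h1, h2⟩, h3⟩
      rcases le_total (z 0) (m : ℝ) with h | h
      · exact Or.inl ⟨⟨h1, h⟩, h3⟩
      · exact Or.inr ⟨⟨h, h2⟩, h3⟩
    · rintro (⟨⟨h1, h2⟩, h3⟩ | ⟨⟨h1, h2⟩, h3⟩)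
      · exact ⟨⟨h1, h2.trans hm1⟩, h3⟩
      · exact ⟨⟨hm2.trans h1, h2⟩, h3⟩
  · refine measure_mono_null (fun z hz => ?_)
      (KZ.volume_setOf_init_mem_eq_zero (n := 1) (KZ.volume_setOf_last_eq_zero (n := 0) (m : ℝ)))
    simp only [LB_domain, mem_inter_iff, mem_bandOf, LogArg.restr_v] at hz
    show Fin.init z (Fin.last 0) = (m : ℝ)
    exact le_antisymm (by simpa using hz.1.1.2) (by simpa using hz.2.1.1)

/-- **Product rule** `log(VW) = log V + log W` (Fubini + affine change of variables + additivity,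
`KZ.of_sub_of_sub_mem_relations_mul`). -/
theorem rel_mul (a b : ℚ) (Wt : BaseWt a b) (V W VW : LogArg a b)
    (hVW : ∀ t ∈ Icc (a : ℝ) b, VW.v t = V.v t * W.v t) :
    KZ.of (LB a b Wt VW) - KZ.of (LB a b Wt V) - KZ.of (LB a b Wt W) ∈ KZ.relations := by
  have hσ := isSemialgebraic_ivl a b
  refine KZ.of_sub_of_sub_mem_relations_mul (σ := ivl a b) (u := fun y => V.v (y 0))
    (w := fun y => W.v (y 0)) (g := fun y => Wt.w (y 0)) hσ V.sa W.sa
    (fun y hy => V.one_le _ hy) (fun y hy => W.one_le _ hy)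
    (LB a b Wt VW) (LB a b Wt V) (LB a b Wt W) ?_ (fun z _ => rfl) rfl (fun z _ => rfl) rfl (fun z _ => rfl)
  simp only [LB_domain, bandOf]
  exact KZlog.band_congr fun y hy => hVW (y 0) hy

/-- Same, with `V = W`: `LB(w, V²) ≡ 2 LB(w, V)`. -/
theorem rel_sq (a b : ℚ) (Wt : BaseWt a b) (V VV : LogArg a b)
    (hVV : ∀ t ∈ Icc (a : ℝ) b, VV.v t = V.v t * V.v t) :
    KZ.of (LB a b Wt VV) - 2 • KZ.of (LB a b Wt V) ∈ KZ.relations := by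
  have := rel_mul a b Wt V V VV hVV; rwa [sub_sub, ← two_nsmul] at this

/-- Two `LB`'s on the same interval whose arguments and weights agree on it are congruent. -/
theorem rel_congr (a b : ℚ) (Wt Wt' : BaseWt a b) (V W : LogArg a b)
    (hw : ∀ t ∈ Icc (a : ℝ) b, Wt.w t = Wt'.w t) (h : ∀ t ∈ Icc (a : ℝ) b, V.v t = W.v t) :
    KZ.of (LB a b Wt V) - KZ.of (LB a b Wt' W) ∈ KZ.relations :=
  KZ.of_sub_of_mem_relations_of_eqOn (by
    simp only [LB_domain, bandOf]; exact KZlog.band_congr fun y hy => (h (y 0) hy).symm) fun z hz => by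
      simp only [LB_integrand]; rw [hw _ (mem_bandOf.1 hz).1]

end Summit.KontsevichZagierPeriods.RootDecompQuadraticDescent.SurdPairs

end
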